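import Literature.MathematicalPhysics.QuantumLattice.HubbardNNNHoppingCorrelatorWindowCertificate
import Literature.MathematicalPhysics.QuantumLattice.InfVolFermionStateCompactness
import Literature.MathematicalPhysics.QuantumLattice.InfVolFermionStateDensity
import HarnessLib

/-!
# `t–t'` Hubbard model: window certificates with an energy constraint bound the correlators of
# TORUS-LIMIT ground states of `ℤ²` at every filling (the thermodynamic-limit edge)

Family `hubbard` (topic `MathematicalPhysics/QuantumLattice`). The tree proves the finite-torus
statement `re_orbitState_ge_of_window_certificate_d4_TT'_ineq`
(`HubbardNNNHoppingCorrelatorWindowCertificate`): ONE window identity in `𝔄_{Λ'}` with an energy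
term `κ (u·1 − Γ(incl) E^{tt'}_Φ)` (Wang et al. 2024 §III: the ground state is feasible for the
relaxation with the constraint `⟨E_up − H⟩ ≥ 0`) and Han's square-lattice constraint set (Han 2020
§3: positivity, stationarity, translations and affine `D₄` maps, charges, density) bounds, for every
`L ≥ 3` and every unit eigenvector `ψ` of the sector `(2n, S^z = 0)` of `hubbardTorusTT' L t t' U`,
the orbit-averaged expectation `Re ω̄_ψ(Γ(ι_{Λ',L}) X)` over the space-group family `U_w D_γ`
(`w ∈ (ℤ/Lℤ)²`, `γ ∈ S ⊆ D₄`), with the signed slack `κ (u − E/L²)` — uniformly in `L`. The tree also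
has, for the pure Hubbard model AT HALF FILLING, the passage from such finite-torus bounds to
infinite-volume torus-limit ground states (`InfVolFermionState.IsTorusLimitOf.re_expect_ge_of_window_certificate_d4_ineq`,
`HubbardCorrelatorCertificate`; there Lieb's uniqueness theorem makes the half-filled ground state of
every even torus unique and `D₄`-invariant). This file gives the thermodynamic-limit edge for the
`t–t'` model at EVERY filling `0 ≤ n < 2`, where no uniqueness is available, in the honest form that
survives degeneracy:

* `orbitState_spaceGroupUnitary_eq_sum_expect_conj` / `…_fermionEmbed_toTorusEmb` — the DICTIONARY:
  the orbit state of `ψ` over `(U_w D_γ)_{w, γ ∈ S}` evaluated on the pull-back `Γ(ι_{Λ',L}) X` of a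
  window observable is the MEAN over `γ ∈ S` of the translation-averaged expectations
  (`torusAvgExpectAt`, the quantity whose limits define torus-limit states) of the ROTATED window
  observables `Γ(d4Emb γ 0) X ∈ 𝔄_{γΛ'}` in `ψ` itself (`D_γ Γ(ι_{Λ'}) X D_γᴴ = Γ(ι_{γΛ'})(Γ(d4Emb γ 0) X)`,
  the tree's `fermionEmbed_toTorusEmb_d4Emb`);
* `InfVolFermionState.IsTorusLimitOf.re_sum_expect_d4_ge_of_window_certificate_TT'_ineq` — the
  THERMODYNAMIC LIMIT: let `ψ_L` be unit ground states of the sectors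
  `(rectN n L = 2⌊nL²/2⌋, S^z = 0)` of `hubbardTorusTT' L t t' U` along sides `Ls → ∞` (`U ≥ 0`,
  `0 ≤ n < 2`), let `ω` be a torus limit of `ψ` along `Ls` (`InfVolFermionState.IsTorusLimitOf`), and
  suppose the thermodynamic-limit energy density satisfies the (certified) bound
  `energyDensityTT' t t' U n ≤ u`. Then a window certificate with energy constraint `(κ ≥ 0, u)`
  whose point-group labels lie in `S` proves
  `c − Σₖ ‖aₖ‖ + (Σ_σ μ_σ)(n/2 − ν) ≤ |S|⁻¹ Σ_{γ ∈ S} Re ω_{γΛ'}(Γ(d4Emb γ 0) X)`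
  — a bound on the `S`-ORBIT MEAN of the expectations of the rotated copies of `X` in `ω` (the slack
  `κ (u − E_L/L²)` passes to the limit through `tendsto_energyDensityTT'_torus` and is then
  nonnegative; no identification of `ω`'s own energy density is needed);
* `InfVolFermionState.IsTorusLimitOf.re_expect_ge_of_window_certificate_TT'_ineq` — the corollary for
  certificates using TRANSLATION reductions only (`S = {1}`, all `γₗ = 1`):
  `c − Σₖ ‖aₖ‖ + (Σ_σ μ_σ)(n/2 − ν) ≤ Re ω_{Λ'}(X)` for every such torus-limit ground state `ω` — the
  shape of the venture's doped torus-limit correlator rows;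
* `InfVolFermionState.IsTorusLimitOf.re_expect_ge_of_window_certificate_d4_TT'_ineq_of_invariant` —
  the corollary for a torus limit `ω` that is invariant under the point-group elements of `S` on the
  rotated copies of `X` (`ω_{γΛ'}(Γ(d4Emb γ 0) X) = ω_{Λ'}(X)`): then a `D₄`-reduced certificate bounds
  `Re ω_{Λ'}(X)` itself;
* `exists_isTorusLimitOf_sectorGroundState_TT'` — NON-VACUITY: along every `Ls → ∞` there are unit
  sector ground states `ψ_L` (every `L`), a subsequence and an infinite-volume state `ω` of the lattice
  fermions on `ℤ²` which is their torus limit; every such `ω` is translation invariant, even, and has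
  density `n` (`…_isTranslationInvariant`, `…_isEven`, `…_density_eq`);
* `InfVolFermionState.IsTorusLimitOf.meanEnergy_hubbardTTPrime_eq_energyDensityTT'` — the ENERGY of the
  limits: every such torus limit carries Ruelle's energy density,
  `ω.meanEnergy (hubbardTTPrimeFermionInteraction t t' U) 1 = energyDensityTT' t t' U n` (the attained
  half of the variational characterisation of `energyDensityTT'` at density `n`, the `t–t'` twin of
  `IsTorusLimitOf.hubbardEnergyDensity_eq_energyDensity2D`), and
  `exists_isTorusLimitOf_meanEnergy_hubbardTTPrime_eq` (such a state exists).

HONEST SCOPE. A certificate using point-group (`γₗ ≠ 1`) reductions does NOT by itself bound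
`Re ω(X)` for a single torus limit `ω` of ground VECTORS: the point-group defects `U_γ Y U_γᴴ − Y` need
not average to zero in the translation average of a vector inside a degenerate ground multiplet (the
caveat printed in `HubbardNNNHoppingPairCorrelatorD4Certificate`); what it bounds is the orbit mean
above, or `Re ω(X)` for point-group-symmetric limits. This is the soundness edge of a
thermodynamic-limit correlator table for the doped `t–t'` model; it makes no claim on the Hubbard
ground state itself. Everything is PROVED; no definition, no named fact.

## References
* J. Wang, J. Surace, I. Frérot, B. Legat, M.-O. Renou, V. Magron, A. Acín, *Certifying ground-state
  properties of many-body systems*, Phys. Rev. X 14 (2024) 031006, §III (energy constraint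
  `⟨E_up − H⟩ ≥ 0` in the relaxation of `⟨O⟩`). [cite: WangEtAl2024, §III]
* X. Han, *Quantum many-body bootstrap*, arXiv:2006.06002 (2020), §2 eq. (2)–(3), §3 (translation,
  point-group, charge and density constraints of the square lattice). [cite: Han2020Bootstrap, §3]
* O. Bratteli, D. W. Robinson, *Operator Algebras and Quantum Statistical Mechanics II*, 2nd ed.
  (Springer 1997), §6.2.4 (periodic states, space-group averages, mean values per site) and I §4.3.1
  (invariant states as averages over the group). [cite: BratteliRobinsonII1997, §6.2.4]
  [cite: BratteliRobinsonI1987, §4.3.1]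
* D. Ruelle, *Statistical Mechanics: Rigorous Results* (1969), §3.3–§3.4 (thermodynamic limit of the
  ground-state energy per site at fixed density). [cite: Ruelle1969, §3.3]
* H. Xu et al., Science 384 (2024) eadh7691, eq. (1) (the `t–t'` Hubbard Hamiltonian).
  [cite: XuEtAl2024, eq. (1)]
-/

noncomputable section

namespace Literature.MathematicalPhysics.QuantumLattice

open Matrix Finset HubbardWave0 Literature.Probability.LatticeModels
open Literature.MathematicalPhysics.QuantumManyBody.StateRelaxation
open _root_.Filter
open scoped ComplexOrder BigOperators _root_.Topology

/-! ### Affine `D₄` images of regions fit into the same tori -/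

section Regions

/-- `d4Vec 1 = id` (`1 = r 0` in Mathlib's `DihedralGroup 4`; the identity of the point group acts
trivially on `ℤ²`). [cite: Scalapino1995, §2] -/
theorem d4Vec_one (e : Site 2) : d4Vec 1 e = e := by
  rw [DihedralGroup.one_def]
  rfl

/-- `Torus.proj` is additive. [folklore] -/
private theorem proj_add_tl (L : ℕ) (x y : Site 2) :
    Torus.proj L (x + y) = Torus.proj L x + Torus.proj L y := by
  funext i
  simp [Torus.proj]

/-- **An affine `D₄` image `γΛ + w` of a region fits into the torus of side `L` iff `Λ` does**
(`x ↦ x mod L` intertwines `x ↦ γx + w` with the bijection `x̄ ↦ γx̄ + w̄` of the torus,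
`Torus.proj_d4Vec`). [cite: Scalapino1995, §2] -/
theorem injOn_proj_d4ShiftSet_iff (L : ℕ) (γ : DihedralGroup 4) (w : Site 2) (Λ : Finset (Site 2)) :
    Set.InjOn (Torus.proj (d := 2) L) ↑(d4ShiftSet γ w Λ) ↔ Set.InjOn (Torus.proj (d := 2) L) ↑Λ := by
  constructor
  · intro h x hx y hy hxy
    have hx' : d4Vec γ x + w ∈ (d4ShiftSet γ w Λ : Set (Site 2)) := by
      rw [Finset.mem_coe]; exact d4Vec_add_mem_d4ShiftSet γ w hx
    have hy' : d4Vec γ y + w ∈ (d4ShiftSet γ w Λ : Set (Site 2)) := by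
      rw [Finset.mem_coe]; exact d4Vec_add_mem_d4ShiftSet γ w hy
    have key := h hx' hy' (by rw [proj_add_tl, proj_add_tl, Torus.proj_d4Vec, Torus.proj_d4Vec, hxy])
    exact d4Vec_injective γ (add_right_cancel key)
  · intro h x hx y hy hxy
    rw [Finset.mem_coe, d4ShiftSet, Finset.mem_map] at hx hy
    obtain ⟨x₀, hx₀, rfl⟩ := hx
    obtain ⟨y₀, hy₀, rfl⟩ := hy
    have hxy' : d4Site γ (Torus.proj L x₀) = d4Site γ (Torus.proj L y₀) := by
      have h' := hxy
      simp only [Function.Embedding.coeFn_mk] at h'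
      rw [proj_add_tl, proj_add_tl, Torus.proj_d4Vec, Torus.proj_d4Vec] at h'
      exact add_right_cancel h'
    have hxy₀ : x₀ = y₀ := h (Finset.mem_coe.2 hx₀) (Finset.mem_coe.2 hy₀) (d4Site_injective γ hxy')
    simp only [Function.Embedding.coeFn_mk, hxy₀]

/-- A region lies inside its trivial affine image `1·Λ + 0` (indeed equals it). [folklore] -/
private theorem subset_d4ShiftSet_one_zero (Λ : Finset (Site 2)) : Λ ⊆ d4ShiftSet 1 0 Λ := by
  intro x hx
  have h := d4Vec_add_mem_d4ShiftSet (1 : DihedralGroup 4) (0 : Site 2) hx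
  rwa [d4Vec_one, add_zero] at h

/-- The trivial affine map `d4Emb 1 0 Λ` is the inclusion `Λ ⊆ 1·Λ + 0`. [folklore] -/
private theorem PolySite.d4Emb_one_zero_apply {Λ : Finset (Site 2)} (y : PolySite Λ) :
    PolySite.d4Emb 1 0 Λ y = PolySite.incl (subset_d4ShiftSet_one_zero Λ) y := by
  refine Subtype.ext ?_
  show toLex (d4Vec 1 (ofLex y.1) + 0) = y.1
  rw [d4Vec_one, add_zero]
  rfl

/-- `Γ(d4Emb 1 0 Λ) = Γ(incl)` on operators. [folklore] -/
private theorem fermionEmbed_d4Emb_one_zero {Λ : Finset (Site 2)} (A : FermionOp Λ) :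
    fermionEmbed (PolySite.d4Emb 1 0 Λ) A = fermionEmbed (PolySite.incl (subset_d4ShiftSet_one_zero Λ)) A := by
  rw [fermionEmbed_congr (fun y => PolySite.d4Emb_one_zero_apply y)]

/-- Hence every infinite-volume state takes the same value on `Γ(d4Emb 1 0 Λ) A ∈ 𝔄_{1·Λ+0}` as on
`A ∈ 𝔄_Λ` (compatibility of the local functionals). [cite: ArakiMoriya2003, §4.1 Def. 4.1 (2)] -/
theorem InfVolFermionState.expect_fermionEmbed_d4Emb_one_zero (ω : InfVolFermionState 2)
    {Λ : Finset (Site 2)} (A : FermionOp Λ) :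
    ω.expect (d4ShiftSet 1 0 Λ) (fermionEmbed (PolySite.d4Emb 1 0 Λ) A) = ω.expect Λ A := by
  rw [fermionEmbed_d4Emb_one_zero, ω.compatible]

end Regions

/-! ### The dictionary: orbit states over `U_w D_γ` versus translation averages -/

section Dictionary

variable {L : ℕ} [NeZero L]

/-- Expectation in a conjugated vector: `⟨Mᴴ φ, A Mᴴ φ⟩ = ⟨φ, (M A Mᴴ) φ⟩`. [folklore] -/
private theorem expect_conjTranspose_mulVec {ι : Type*} [LinearOrder ι] [Fintype ι]
    (A M : Matrix (Finset ι) (Finset ι) ℂ) (φ : Fock ι) :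
    expect A (Mᴴ *ᵥ φ) = expect (M * A * Mᴴ) φ := by
  unfold expect
  rw [star_mulVec, conjTranspose_conjTranspose, ← dotProduct_mulVec, mulVec_mulVec, mulVec_mulVec]

/-- `(U_w D_γ)ᴴ ψ = D_γᴴ (U_{−w} ψ)`. [folklore] -/
private theorem spaceGroupUnitary_conjTranspose_mulVec (S : Finset (DihedralGroup 4))
    (g : TorusSite 2 L × ↥S) (ψ : Fock (Orb (FermionTorus 2 L))) :
    (spaceGroupUnitary S g)ᴴ *ᵥ ψ =
      (fockD4 (L := L) (g.2 : DihedralGroup 4)).valᴴ *ᵥ ((fockTranslate (-g.1)).val *ᵥ ψ) := by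
  show ((fockTranslate g.1).val * (fockD4 (L := L) (g.2 : DihedralGroup 4)).val)ᴴ *ᵥ ψ = _
  rw [conjTranspose_mul, fockTranslate_val_conjTranspose, mulVec_mulVec]

/-- **The orbit state over the space-group family is a mean of translation averages**: for every
torus operator `X`,
`ω̄_ψ(X) = |S|⁻¹ Σ_{γ ∈ S} L⁻² Σ_v ⟨U_v ψ, (D_γ X D_γᴴ) U_v ψ⟩`
(`(U_w D_γ)ᴴ ψ = D_γᴴ U_{−w} ψ`, and `w ↦ −w` is a bijection of the torus).
[cite: BratteliRobinsonII1997, §6.2.4] -/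
theorem orbitState_spaceGroupUnitary_eq_sum_expect_conj (S : Finset (DihedralGroup 4))
    (ψ : Fock (Orb (FermionTorus 2 L)))
    (X : Matrix (Finset (Orb (FermionTorus 2 L))) (Finset (Orb (FermionTorus 2 L))) ℂ) :
    orbitState (spaceGroupUnitary S) ψ X =
      (S.card : ℂ)⁻¹ * ∑ γ ∈ S, (((Fintype.card (TorusSite 2 L) : ℂ))⁻¹ *
        ∑ v : TorusSite 2 L, expect ((fockD4 (L := L) γ).val * X * (fockD4 (L := L) γ).valᴴ)
          ((fockTranslate v).val *ᵥ ψ)) := by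
  rw [orbitState_apply, Fintype.card_prod, Fintype.card_coe, Nat.cast_mul, ← Finset.mul_sum, ← mul_assoc,
    ← _root_.mul_inv_rev, ← Finset.sum_coe_sort S]
  conv_lhs => rw [Fintype.sum_prod_type, Finset.sum_comm]
  refine congrArg _ (Finset.sum_congr rfl fun γ _ => ?_)
  -- reindex `w ↦ -w` and move `D_γᴴ` onto the observable
  refine Fintype.sum_equiv (Equiv.neg (TorusSite 2 L)) _ _ fun w => ?_
  rw [_root_.Literature.MathematicalPhysics.QuantumManyBody.StateRelaxation.vectorState_apply,
    spaceGroupUnitary_conjTranspose_mulVec, Equiv.neg_apply]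
  exact expect_conjTranspose_mulVec X _ _

/-- **The dictionary for window observables.** For a window `Λ' ⊆ ℤ²` fitting into the torus of side
`L` and `X ∈ 𝔄_{Λ'}`, the orbit state of `ψ` over `(U_w D_γ)_{w ∈ (ℤ/Lℤ)², γ ∈ S}` on the pull-back
`Γ(ι_{Λ',L}) X` is the mean over `γ ∈ S` of the TRANSLATION-averaged expectations in `ψ` of the
rotated window observables `Γ(d4Emb γ 0) X ∈ 𝔄_{γΛ'}`:
`ω̄_ψ(Γ(ι_{Λ'}) X) = |S|⁻¹ Σ_{γ∈S} torusAvgExpectAt L (γΛ') (Γ(d4Emb γ 0) X) ψ`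
(`D_γ Γ(ι_{Λ'}) X D_γᴴ = Γ(ι_{γΛ'})(Γ(d4Emb γ 0) X)`, `fermionEmbed_toTorusEmb_d4Emb`).
[cite: BratteliRobinsonII1997, §6.2.4] -/
theorem orbitState_spaceGroupUnitary_fermionEmbed_toTorusEmb (S : Finset (DihedralGroup 4))
    {Λ' : Finset (Site 2)} (hInj' : Set.InjOn (Torus.proj (d := 2) L) ↑Λ')
    (Xw : FermionOp Λ') (ψ : Fock (Orb (FermionTorus 2 L))) :
    orbitState (spaceGroupUnitary S) ψ (fermionEmbed (PolySite.toTorusEmb L hInj') Xw) =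
      (S.card : ℂ)⁻¹ * ∑ γ ∈ S,
        torusAvgExpectAt L (d4ShiftSet γ 0 Λ') (fermionEmbed (PolySite.d4Emb γ 0 Λ') Xw) ψ := by
  rw [orbitState_spaceGroupUnitary_eq_sum_expect_conj S]
  refine congrArg _ (Finset.sum_congr rfl fun γ _ => ?_)
  have hInjγ : Set.InjOn (Torus.proj (d := 2) L) ↑(d4ShiftSet γ 0 Λ') :=
    (injOn_proj_d4ShiftSet_iff L γ 0 Λ').2 hInj'
  rw [torusAvgExpectAt_of_injOn L hInjγ]
  refine congrArg _ (Finset.sum_congr rfl fun v _ => ?_)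
  congr 1
  have hproj0 : Torus.proj L (0 : Site 2) = 0 := by
    funext i
    simp [Torus.proj]
  rw [fermionEmbed_toTorusEmb_d4Emb γ 0 hInj' hInjγ Xw, hproj0, Orb.translate_zero, Equiv.Perm.one_def,
    relabel_refl, relabel_eq_fockRelabel_conj, fockD4_apply]

/-- Real parts: `Re ω̄_ψ(Γ(ι_{Λ'}) X) = |S|⁻¹ Σ_{γ∈S} Re torusAvgExpectAt L (γΛ') (Γ(d4Emb γ 0) X) ψ`.
[cite: BratteliRobinsonII1997, §6.2.4] -/
theorem re_orbitState_spaceGroupUnitary_fermionEmbed_toTorusEmb (S : Finset (DihedralGroup 4))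
    {Λ' : Finset (Site 2)} (hInj' : Set.InjOn (Torus.proj (d := 2) L) ↑Λ')
    (Xw : FermionOp Λ') (ψ : Fock (Orb (FermionTorus 2 L))) :
    (orbitState (spaceGroupUnitary S) ψ (fermionEmbed (PolySite.toTorusEmb L hInj') Xw)).re =
      (S.card : ℝ)⁻¹ * ∑ γ ∈ S,
        (torusAvgExpectAt L (d4ShiftSet γ 0 Λ') (fermionEmbed (PolySite.d4Emb γ 0 Λ') Xw) ψ).re := by
  rw [orbitState_spaceGroupUnitary_fermionEmbed_toTorusEmb S hInj', ← Complex.ofReal_natCast,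
    ← Complex.ofReal_inv, Complex.re_ofReal_mul, Complex.re_sum]

end Dictionary

/-! ### Unit ground states of a sector and their basic invariances -/

section SectorGroundStates

/-- Card of the fermionic torus `(ℤ/Lℤ)²`. [folklore] -/
private theorem card_fermionTorus_two (L : ℕ) : Fintype.card (FermionTorus 2 L) = L ^ 2 := by
  simp [FermionTorus]

/-- `rectN n L = 2 · ⌊nL²/2⌋` (definitional). [folklore] -/
private theorem rectN_eq_two_mul (n : ℝ) (L : ℕ) :
    ThermodynamicLimit.rectN n L = 2 * ⌊n * (L : ℝ) ^ 2 / 2⌋₊ := rfl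

/-- Half the sector particle number is at most the number of sites (`0 ≤ n ≤ 2`). [folklore] -/
private theorem half_rectN_le_card {n : ℝ} (hn0 : 0 ≤ n) (hn2 : n ≤ 2) (L : ℕ) :
    ⌊n * (L : ℝ) ^ 2 / 2⌋₊ ≤ Fintype.card (FermionTorus 2 L) := by
  have h := ThermodynamicLimit.rectN_le_two_mul hn0 hn2 L
  rw [rectN_eq_two_mul, ← sq] at h
  rw [card_fermionTorus_two]
  exact Nat.le_of_mul_le_mul_left h two_pos

/-- **Every sector `(rectN n L, S^z = 0)` of the `t–t'` torus has a unit ground state** (`0 ≤ n ≤ 2`;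
the sector is non-trivial and invariant, and the sector energy is attained at an eigenvector,
`exists_unit_eigen_minEnergyOn`). [cite: LiebPRL1989, proof of Theorem 1] -/
theorem exists_unit_isGroundStateInSector_hubbardTorusTT' (L : ℕ) (t t' U : ℝ) {n : ℝ} (hn0 : 0 ≤ n)
    (hn2 : n ≤ 2) :
    ∃ ψ : Fock (Orb (FermionTorus 2 L)),
      IsGroundStateInSector (hubbardTorusTT' L t t' U) (ThermodynamicLimit.rectN n L) 0 ψ ∧
        star ψ ⬝ᵥ ψ = 1 := by
  set K : Submodule ℂ (Fock (Orb (FermionTorus 2 L))) := szSector (ThermodynamicLimit.rectN n L) 0 with hK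
  have hKne : K ≠ ⊥ := by
    rw [hK, rectN_eq_two_mul]
    exact szSector_ne_bot t U (half_rectN_le_card hn0 hn2 L)
  have hKA : ∀ v ∈ K, hubbardTorusTT' L t t' U *ᵥ v ∈ K := fun v hv =>
    mulVec_mem_szSector_of_commute (hubbardTorusTT'_commute_totalNumber L t t' U)
      (hubbardTorusTT'_commute_spinZ L t t' U) hv
  obtain ⟨ψ, hψK, hψ1, hHψ⟩ :=
    exists_unit_eigen_minEnergyOn (hubbardTorusTT'_isHermitian L t t' U) K hKA hKne
  refine ⟨ψ, ⟨hψK, ?_, hHψ⟩, hψ1⟩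
  intro h0
  rw [h0, dotProduct_zero] at hψ1
  exact zero_ne_one hψ1

/-- A sector ground state of `(N, S^z = M)` is an `N`-particle vector. [folklore] -/
private theorem IsGroundStateInSector.isNParticle {L : ℕ}
    {H : Matrix (Finset (Orb (FermionTorus 2 L))) (Finset (Orb (FermionTorus 2 L))) ℂ} {N : ℕ} {M : ℝ}
    {ψ : Fock (Orb (FermionTorus 2 L))} (h : IsGroundStateInSector H N M ψ) : IsNParticle N ψ :=
  ((mem_szSector_iff N M ψ).1 h.1).1

end SectorGroundStates

/-! ### The thermodynamic limit: torus-limit ground states of the doped `t–t'` model -/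

section Limit

/-- **Window certificate with an energy constraint ⇒ orbit-mean correlator bound for every
torus-limit ground state of the `t–t'` Hubbard model on `ℤ²`, at every filling.** Data: the window
identity of `re_orbitState_ge_of_window_certificate_d4_TT'_ineq` (objective `X ∈ 𝔄_{Λ'}`, density
multipliers `μ_σ`, `ν`, energy constraint `(κ, u)`, Han's constraint families, point-group labels
`γₗ ∈ S` for a finite `S ∋ 1` closed under multiplication), `κ ≥ 0`, `U ≥ 0`, `0 ≤ n < 2`, and the
thermodynamic-limit energy bound `energyDensityTT' t t' U n ≤ u`. Let `ψ_L` be unit ground states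
of the sectors `(rectN n L, S^z = 0)` of `hubbardTorusTT' L t t' U` along sides `Ls → ∞`, and `ω` a
torus limit of `ψ` along `Ls`. Then
`c − Σₖ ‖aₖ‖ + (Σ_σ μ_σ)(n/2 − ν) ≤ |S|⁻¹ Σ_{γ∈S} Re ω_{γΛ'}(Γ(d4Emb γ 0) X)`.
(Finite tori: the orbit-state bound with slack `κ (u − E_L/L²)`; dictionary
`orbitState_spaceGroupUnitary_fermionEmbed_toTorusEmb`; `E_L/L² → energyDensityTT' t t' U n`
(`tendsto_energyDensityTT'_torus`), `rectN n L/L² → n`; the limit slack `κ (u − e) ≥ 0` is dropped.)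
Wang et al. 2024 §III; Han 2020 §3; Bratteli–Robinson II §6.2.4. [cite: WangEtAl2024, §III] -/
theorem InfVolFermionState.IsTorusLimitOf.re_sum_expect_d4_ge_of_window_certificate_TT'_ineq
    (t t' : ℝ) {U : ℝ} (hU : 0 ≤ U) {n : ℝ} (hn0 : 0 ≤ n) (hn2 : n < 2) {κ u : ℝ} (hκ : 0 ≤ κ)
    (hu : ThermodynamicLimit.energyDensityTT' t t' U n ≤ u)
    {Λ Λ' : Finset (Site 2)} (hΛ : Λ ⊆ Λ') (h8 : thicken Λ 1 ⊆ Λ')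
    (h0 : thicken ({0} : Finset (Site 2)) 1 ⊆ Λ') (hz : (0 : Site 2) ∈ Λ')
    {S : Finset (DihedralGroup 4)} (h1 : (1 : DihedralGroup 4) ∈ S) (hmul : ∀ a ∈ S, ∀ b ∈ S, a * b ∈ S)
    (Xw : FermionOp Λ') (μ : Fin 2 → ℝ) (ν : ℝ)
    {m : Type*} [Fintype m] [DecidableEq m] {Λm : Matrix m m ℂ} (hΛm : Λm.PosSemidef)
    (O : m → FermionOp Λ')
    {κ' : Type*} (s : Finset κ') (B : κ' → FermionOp Λ)
    {ι : Type*} (tt : Finset ι) (γ : ι → DihedralGroup 4) (hγS : ∀ l ∈ tt, γ l ∈ S) (wv : ι → Site 2)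
    (hsh : ∀ l, d4ShiftSet (γ l) (wv l) Λ ⊆ Λ') (Y : ι → FermionOp Λ)
    {ρ : Type*} (uu : Finset ρ) (b : ρ → ℂ) (cw : ρ → List (Orb (PolySite Λ') × Bool))
    (hcw : ∀ j ∈ uu, ladderCharge (cw j) ≠ 0 ∨ ladderSpinCharge (cw j) ≠ 0)
    {δ : Type*} (ah : Finset δ) (dc : δ → ℝ) (V : δ → FermionOp Λ')
    {κ'' : Type*} (w : Finset κ'') (a : κ'' → ℂ) (word : κ'' → List (Orb (PolySite Λ') × Bool)) {c : ℝ}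
    (hcert : Xw - (c : ℂ) • (1 : FermionOp Λ') -
        ∑ σ : Fin 2, ((μ σ : ℝ) : ℂ) • (nAt 0 hz σ - ((ν : ℝ) : ℂ) • (1 : FermionOp Λ')) -
        ((κ : ℝ) : ℂ) • (((u : ℝ) : ℂ) • (1 : FermionOp Λ') -
          fermionEmbed (PolySite.incl h0) ((hubbardTTPrimeFermionInteraction t t' U).meanEnergyObs 1)) =
      gramForm Λm O +
        (∑ k ∈ s, ((hubbardTTPrimeFermionInteraction t t' U).localHamiltonian Λ' * fermionEmbed (PolySite.incl hΛ) (B k) -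
            fermionEmbed (PolySite.incl hΛ) (B k) * (hubbardTTPrimeFermionInteraction t t' U).localHamiltonian Λ') +
          ∑ l ∈ tt, (fermionEmbed (PolySite.incl (hsh l)) (fermionEmbed (PolySite.d4Emb (γ l) (wv l) Λ) (Y l)) -
            fermionEmbed (PolySite.incl hΛ) (Y l)) +
          ∑ j ∈ uu, b j • ladderWord (cw j)) +
        (∑ m' ∈ ah, ((dc m' : ℝ) : ℂ) • ((V m')ᴴ - V m') + ∑ k ∈ w, a k • ladderWord (word k)))
    {Ls : ℕ → ℕ} (hLs : Tendsto Ls atTop atTop)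
    {ψ : ∀ L, Fock (Orb (FermionTorus 2 L))}
    (hψ : ∀ j, IsGroundStateInSector (hubbardTorusTT' (Ls j) t t' U)
      (ThermodynamicLimit.rectN n (Ls j)) 0 (ψ (Ls j)))
    (hψ1 : ∀ j, star (ψ (Ls j)) ⬝ᵥ ψ (Ls j) = 1)
    {ω : InfVolFermionState 2} (hω : ω.IsTorusLimitOf ψ Ls) :
    c - ∑ k ∈ w, ‖a k‖ + (∑ σ : Fin 2, μ σ) * (n / 2 - ν) ≤
      (S.card : ℝ)⁻¹ * ∑ g ∈ S,
        (ω.expect (d4ShiftSet g 0 Λ') (fermionEmbed (PolySite.d4Emb g 0 Λ') Xw)).re := by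
  -- the averaged torus expectations of the rotated observables converge to their values in `ω`
  have hlim : Tendsto (fun j => (S.card : ℝ)⁻¹ * ∑ g ∈ S,
      (torusAvgExpect (Ls j) (d4ShiftSet g 0 Λ') (fermionEmbed (PolySite.d4Emb g 0 Λ') Xw) (ψ (Ls j))).re)
      atTop (𝓝 ((S.card : ℝ)⁻¹ * ∑ g ∈ S,
        (ω.expect (d4ShiftSet g 0 Λ') (fermionEmbed (PolySite.d4Emb g 0 Λ') Xw)).re)) := by
    refine (tendsto_finsetSum S fun g _ => ?_).const_mul _
    exact (Complex.continuous_re.tendsto _).comp (hω (d4ShiftSet g 0 Λ') _)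
  -- the energies per site converge to the thermodynamic-limit density, the fillings to `n/2`
  have hE : Tendsto (fun j => groundEnergy (hubbardTorusTT' (Ls j) t t' U) (ThermodynamicLimit.rectN n (Ls j)) /
      ((Ls j : ℕ) : ℝ) ^ 2) atTop (𝓝 (ThermodynamicLimit.energyDensityTT' t t' U n)) :=
    (ThermodynamicLimit.tendsto_energyDensityTT'_torus t t' hU hn0 hn2).comp hLs
  have hN : Tendsto (fun j => (ThermodynamicLimit.rectN n (Ls j) : ℝ) / 2 / ((Ls j : ℕ) : ℝ) ^ 2) atTop
      (𝓝 (n / 2)) := by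
    have h := ((ThermodynamicLimit.tendsto_rectN_div_sq hn0).comp hLs).div_const 2
    refine h.congr fun j => ?_
    simp only [Function.comp_apply]
    ring
  set b0 : ℝ := c - ∑ k ∈ w, ‖a k‖ with hb0
  have hbnd : Tendsto (fun j => b0 + (∑ σ : Fin 2, μ σ) *
      ((ThermodynamicLimit.rectN n (Ls j) : ℝ) / 2 / ((Ls j : ℕ) : ℝ) ^ 2 - ν) +
      κ * (u - groundEnergy (hubbardTorusTT' (Ls j) t t' U) (ThermodynamicLimit.rectN n (Ls j)) /
        ((Ls j : ℕ) : ℝ) ^ 2)) atTop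
      (𝓝 (b0 + (∑ σ : Fin 2, μ σ) * (n / 2 - ν) + κ * (u - ThermodynamicLimit.energyDensityTT' t t' U n))) :=
    (tendsto_const_nhds.add ((hN.sub_const ν).const_mul _)).add ((tendsto_const_nhds.sub hE).const_mul κ)
  -- the finite-torus inequality holds for all large `j`
  have hev' : ∀ᶠ j in atTop, b0 + (∑ σ : Fin 2, μ σ) *
      ((ThermodynamicLimit.rectN n (Ls j) : ℝ) / 2 / ((Ls j : ℕ) : ℝ) ^ 2 - ν) +
      κ * (u - groundEnergy (hubbardTorusTT' (Ls j) t t' U) (ThermodynamicLimit.rectN n (Ls j)) /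
        ((Ls j : ℕ) : ℝ) ^ 2) ≤
      (S.card : ℝ)⁻¹ * ∑ g ∈ S,
        (torusAvgExpect (Ls j) (d4ShiftSet g 0 Λ') (fermionEmbed (PolySite.d4Emb g 0 Λ') Xw) (ψ (Ls j))).re := by
    filter_upwards [eventually_injOn_proj_of_tendsto (thicken Λ' 1) hLs, hLs.eventually_ge_atTop 3]
      with j hInj hL3
    haveI : NeZero (Ls j) := ⟨by omega⟩
    have hInj' : Set.InjOn (Torus.proj (d := 2) (Ls j)) ↑Λ' :=
      hInj.mono (by exact_mod_cast subset_thicken Λ' 1)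
    -- the sector `(rectN n L, 0) = (2 nh, 0)`
    set nh : ℕ := ⌊n * ((Ls j : ℕ) : ℝ) ^ 2 / 2⌋₊ with hnh
    have hrect : ThermodynamicLimit.rectN n (Ls j) = 2 * nh := rfl
    have hn : nh ≤ Fintype.card (FermionTorus 2 (Ls j)) := half_rectN_le_card hn0 hn2.le (Ls j)
    obtain ⟨hψK, -, hHψ⟩ := hψ j
    rw [hrect] at hψK hHψ
    rw [← groundEnergy_hubbardTorusTT'_eq_minEnergyOn_szSector (Ls j) t t' U hn] at hHψ
    have h := re_orbitState_ge_of_window_certificate_d4_TT'_ineq t t' U hL3 hΛ h8 h0 hz hInj hInj' h1 hmul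
      hψK (hψ1 j) hHψ Xw κ u μ ν hΛm O s B tt γ hγS wv hsh Y uu b cw hcw ah dc V w a word hcert
    rw [re_orbitState_spaceGroupUnitary_fermionEmbed_toTorusEmb S hInj'] at h
    have hcast : (nh : ℝ) = (ThermodynamicLimit.rectN n (Ls j) : ℝ) / 2 := by
      rw [hrect]; push_cast; ring
    rw [hcast, ← hrect] at h
    simp_rw [torusAvgExpect_eq]
    exact h
  have hle := le_of_tendsto_of_tendsto hbnd hlim hev'
  have hslack : 0 ≤ κ * (u - ThermodynamicLimit.energyDensityTT' t t' U n) := mul_nonneg hκ (sub_nonneg.2 hu)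
  linarith

/-- **Translation-only certificates ⇒ the correlator of every torus-limit ground state.** Under the
hypotheses of `…re_sum_expect_d4_ge_of_window_certificate_TT'_ineq` with ALL point-group labels
trivial (`γₗ = 1`: the symmetry family consists of lattice translations `x ↦ x + wₗ` only), every
torus limit `ω` of unit sector ground states `ψ_L ∈ (rectN n L, S^z = 0)` of `hubbardTorusTT' L t t' U`
along `Ls → ∞` obeys
`c − Σₖ ‖aₖ‖ + (Σ_σ μ_σ)(n/2 − ν) ≤ Re ω_{Λ'}(X)`
as soon as `energyDensityTT' t t' U n ≤ u` — the doped, `t' ≠ 0` counterpart of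
`IsTorusLimitOf.re_expect_ge_of_window_certificate_d4_ineq` (pure Hubbard model at half filling).
Wang et al. 2024 §III; Han 2020 §3. [cite: WangEtAl2024, §III] -/
theorem InfVolFermionState.IsTorusLimitOf.re_expect_ge_of_window_certificate_TT'_ineq
    (t t' : ℝ) {U : ℝ} (hU : 0 ≤ U) {n : ℝ} (hn0 : 0 ≤ n) (hn2 : n < 2) {κ u : ℝ} (hκ : 0 ≤ κ)
    (hu : ThermodynamicLimit.energyDensityTT' t t' U n ≤ u)
    {Λ Λ' : Finset (Site 2)} (hΛ : Λ ⊆ Λ') (h8 : thicken Λ 1 ⊆ Λ')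
    (h0 : thicken ({0} : Finset (Site 2)) 1 ⊆ Λ') (hz : (0 : Site 2) ∈ Λ')
    (Xw : FermionOp Λ') (μ : Fin 2 → ℝ) (ν : ℝ)
    {m : Type*} [Fintype m] [DecidableEq m] {Λm : Matrix m m ℂ} (hΛm : Λm.PosSemidef)
    (O : m → FermionOp Λ')
    {κ' : Type*} (s : Finset κ') (B : κ' → FermionOp Λ)
    {ι : Type*} (tt : Finset ι) (γ : ι → DihedralGroup 4) (hγ1 : ∀ l ∈ tt, γ l = 1) (wv : ι → Site 2)
    (hsh : ∀ l, d4ShiftSet (γ l) (wv l) Λ ⊆ Λ') (Y : ι → FermionOp Λ)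
    {ρ : Type*} (uu : Finset ρ) (b : ρ → ℂ) (cw : ρ → List (Orb (PolySite Λ') × Bool))
    (hcw : ∀ j ∈ uu, ladderCharge (cw j) ≠ 0 ∨ ladderSpinCharge (cw j) ≠ 0)
    {δ : Type*} (ah : Finset δ) (dc : δ → ℝ) (V : δ → FermionOp Λ')
    {κ'' : Type*} (w : Finset κ'') (a : κ'' → ℂ) (word : κ'' → List (Orb (PolySite Λ') × Bool)) {c : ℝ}
    (hcert : Xw - (c : ℂ) • (1 : FermionOp Λ') -
        ∑ σ : Fin 2, ((μ σ : ℝ) : ℂ) • (nAt 0 hz σ - ((ν : ℝ) : ℂ) • (1 : FermionOp Λ')) -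
        ((κ : ℝ) : ℂ) • (((u : ℝ) : ℂ) • (1 : FermionOp Λ') -
          fermionEmbed (PolySite.incl h0) ((hubbardTTPrimeFermionInteraction t t' U).meanEnergyObs 1)) =
      gramForm Λm O +
        (∑ k ∈ s, ((hubbardTTPrimeFermionInteraction t t' U).localHamiltonian Λ' * fermionEmbed (PolySite.incl hΛ) (B k) -
            fermionEmbed (PolySite.incl hΛ) (B k) * (hubbardTTPrimeFermionInteraction t t' U).localHamiltonian Λ') +
          ∑ l ∈ tt, (fermionEmbed (PolySite.incl (hsh l)) (fermionEmbed (PolySite.d4Emb (γ l) (wv l) Λ) (Y l)) -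
            fermionEmbed (PolySite.incl hΛ) (Y l)) +
          ∑ j ∈ uu, b j • ladderWord (cw j)) +
        (∑ m' ∈ ah, ((dc m' : ℝ) : ℂ) • ((V m')ᴴ - V m') + ∑ k ∈ w, a k • ladderWord (word k)))
    {Ls : ℕ → ℕ} (hLs : Tendsto Ls atTop atTop)
    {ψ : ∀ L, Fock (Orb (FermionTorus 2 L))}
    (hψ : ∀ j, IsGroundStateInSector (hubbardTorusTT' (Ls j) t t' U)
      (ThermodynamicLimit.rectN n (Ls j)) 0 (ψ (Ls j)))
    (hψ1 : ∀ j, star (ψ (Ls j)) ⬝ᵥ ψ (Ls j) = 1)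
    {ω : InfVolFermionState 2} (hω : ω.IsTorusLimitOf ψ Ls) :
    c - ∑ k ∈ w, ‖a k‖ + (∑ σ : Fin 2, μ σ) * (n / 2 - ν) ≤ (ω.expect Λ' Xw).re := by
  have h1 : (1 : DihedralGroup 4) ∈ ({1} : Finset (DihedralGroup 4)) := Finset.mem_singleton_self 1
  have hmul : ∀ a ∈ ({1} : Finset (DihedralGroup 4)), ∀ b ∈ ({1} : Finset (DihedralGroup 4)),
      a * b ∈ ({1} : Finset (DihedralGroup 4)) := by
    intro a ha b hb
    rw [Finset.mem_singleton] at ha hb ⊢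
    rw [ha, hb, mul_one]
  have hγS : ∀ l ∈ tt, γ l ∈ ({1} : Finset (DihedralGroup 4)) := fun l hl =>
    Finset.mem_singleton.2 (hγ1 l hl)
  have h := hω.re_sum_expect_d4_ge_of_window_certificate_TT'_ineq t t' hU hn0 hn2 hκ hu hΛ h8 h0 hz h1
    hmul Xw μ ν hΛm O s B tt γ hγS wv hsh Y uu b cw hcw ah dc V w a word hcert hLs hψ hψ1
  rwa [Finset.sum_singleton, Finset.card_singleton, Nat.cast_one, inv_one, one_mul,
    ω.expect_fermionEmbed_d4Emb_one_zero] at h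

/-- **Point-group-symmetric torus limits.** Under the hypotheses of
`…re_sum_expect_d4_ge_of_window_certificate_TT'_ineq`, if the torus limit `ω` takes the same value
on every rotated copy `Γ(d4Emb γ 0) X ∈ 𝔄_{γΛ'}` (`γ ∈ S`) as on `X` — e.g. a `D₄`-invariant
infinite-volume ground state — then the `S`-reduced certificate bounds the correlator of `ω` itself:
`c − Σₖ ‖aₖ‖ + (Σ_σ μ_σ)(n/2 − ν) ≤ Re ω_{Λ'}(X)`. [cite: WangEtAl2024, §III] -/
theorem InfVolFermionState.IsTorusLimitOf.re_expect_ge_of_window_certificate_d4_TT'_ineq_of_invariant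
    (t t' : ℝ) {U : ℝ} (hU : 0 ≤ U) {n : ℝ} (hn0 : 0 ≤ n) (hn2 : n < 2) {κ u : ℝ} (hκ : 0 ≤ κ)
    (hu : ThermodynamicLimit.energyDensityTT' t t' U n ≤ u)
    {Λ Λ' : Finset (Site 2)} (hΛ : Λ ⊆ Λ') (h8 : thicken Λ 1 ⊆ Λ')
    (h0 : thicken ({0} : Finset (Site 2)) 1 ⊆ Λ') (hz : (0 : Site 2) ∈ Λ')
    {S : Finset (DihedralGroup 4)} (h1 : (1 : DihedralGroup 4) ∈ S) (hmul : ∀ a ∈ S, ∀ b ∈ S, a * b ∈ S)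
    (Xw : FermionOp Λ') (μ : Fin 2 → ℝ) (ν : ℝ)
    {m : Type*} [Fintype m] [DecidableEq m] {Λm : Matrix m m ℂ} (hΛm : Λm.PosSemidef)
    (O : m → FermionOp Λ')
    {κ' : Type*} (s : Finset κ') (B : κ' → FermionOp Λ)
    {ι : Type*} (tt : Finset ι) (γ : ι → DihedralGroup 4) (hγS : ∀ l ∈ tt, γ l ∈ S) (wv : ι → Site 2)
    (hsh : ∀ l, d4ShiftSet (γ l) (wv l) Λ ⊆ Λ') (Y : ι → FermionOp Λ)
    {ρ : Type*} (uu : Finset ρ) (b : ρ → ℂ) (cw : ρ → List (Orb (PolySite Λ') × Bool))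
    (hcw : ∀ j ∈ uu, ladderCharge (cw j) ≠ 0 ∨ ladderSpinCharge (cw j) ≠ 0)
    {δ : Type*} (ah : Finset δ) (dc : δ → ℝ) (V : δ → FermionOp Λ')
    {κ'' : Type*} (w : Finset κ'') (a : κ'' → ℂ) (word : κ'' → List (Orb (PolySite Λ') × Bool)) {c : ℝ}
    (hcert : Xw - (c : ℂ) • (1 : FermionOp Λ') -
        ∑ σ : Fin 2, ((μ σ : ℝ) : ℂ) • (nAt 0 hz σ - ((ν : ℝ) : ℂ) • (1 : FermionOp Λ')) -
        ((κ : ℝ) : ℂ) • (((u : ℝ) : ℂ) • (1 : FermionOp Λ') -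
          fermionEmbed (PolySite.incl h0) ((hubbardTTPrimeFermionInteraction t t' U).meanEnergyObs 1)) =
      gramForm Λm O +
        (∑ k ∈ s, ((hubbardTTPrimeFermionInteraction t t' U).localHamiltonian Λ' * fermionEmbed (PolySite.incl hΛ) (B k) -
            fermionEmbed (PolySite.incl hΛ) (B k) * (hubbardTTPrimeFermionInteraction t t' U).localHamiltonian Λ') +
          ∑ l ∈ tt, (fermionEmbed (PolySite.incl (hsh l)) (fermionEmbed (PolySite.d4Emb (γ l) (wv l) Λ) (Y l)) -
            fermionEmbed (PolySite.incl hΛ) (Y l)) +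
          ∑ j ∈ uu, b j • ladderWord (cw j)) +
        (∑ m' ∈ ah, ((dc m' : ℝ) : ℂ) • ((V m')ᴴ - V m') + ∑ k ∈ w, a k • ladderWord (word k)))
    {Ls : ℕ → ℕ} (hLs : Tendsto Ls atTop atTop)
    {ψ : ∀ L, Fock (Orb (FermionTorus 2 L))}
    (hψ : ∀ j, IsGroundStateInSector (hubbardTorusTT' (Ls j) t t' U)
      (ThermodynamicLimit.rectN n (Ls j)) 0 (ψ (Ls j)))
    (hψ1 : ∀ j, star (ψ (Ls j)) ⬝ᵥ ψ (Ls j) = 1)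
    {ω : InfVolFermionState 2} (hω : ω.IsTorusLimitOf ψ Ls)
    (hinv : ∀ g ∈ S, ω.expect (d4ShiftSet g 0 Λ') (fermionEmbed (PolySite.d4Emb g 0 Λ') Xw) = ω.expect Λ' Xw) :
    c - ∑ k ∈ w, ‖a k‖ + (∑ σ : Fin 2, μ σ) * (n / 2 - ν) ≤ (ω.expect Λ' Xw).re := by
  have h := hω.re_sum_expect_d4_ge_of_window_certificate_TT'_ineq t t' hU hn0 hn2 hκ hu hΛ h8 h0 hz h1
    hmul Xw μ ν hΛm O s B tt γ hγS wv hsh Y uu b cw hcw ah dc V w a word hcert hLs hψ hψ1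
  have hsum : ∑ g ∈ S, (ω.expect (d4ShiftSet g 0 Λ') (fermionEmbed (PolySite.d4Emb g 0 Λ') Xw)).re =
      (S.card : ℝ) * (ω.expect Λ' Xw).re := by
    rw [Finset.sum_congr rfl fun g hg => by rw [hinv g hg], Finset.sum_const, nsmul_eq_mul]
  have hcard : (S.card : ℝ) ≠ 0 := Nat.cast_ne_zero.2 (Finset.card_pos.2 ⟨1, h1⟩).ne'
  rwa [hsum, inv_mul_cancel_left₀ hcard] at h

/-! ### Non-vacuity: torus-limit ground states of the doped `t–t'` model exist -/

/-- **Torus-limit sector ground states of the `t–t'` model exist along every `Ls → ∞`** (so the class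
quantified over above is not empty): for `0 ≤ n ≤ 2` there are unit ground states `ψ_L` of the sectors
`(rectN n L, S^z = 0)` of `hubbardTorusTT' L t t' U` (every `L`), a subsequence `Ls ∘ φ` and an
infinite-volume state `ω` of the lattice fermions on `ℤ²` which is the torus limit of `ψ` along
`Ls ∘ φ` (weak-⋆ compactness, `InfVolFermionState.exists_isTorusLimitOf_subseq`); `ω` is translation
invariant, even, and has density `n`. [cite: BratteliRobinsonII1997, §6.2.4] -/
theorem exists_isTorusLimitOf_sectorGroundState_TT' (t t' U : ℝ) {n : ℝ} (hn0 : 0 ≤ n) (hn2 : n ≤ 2)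
    {Ls : ℕ → ℕ} (hLs : Tendsto Ls atTop atTop) :
    ∃ (ψ : ∀ L, Fock (Orb (FermionTorus 2 L))) (φ : ℕ → ℕ) (ω : InfVolFermionState 2),
      StrictMono φ ∧
      (∀ L, IsGroundStateInSector (hubbardTorusTT' L t t' U) (ThermodynamicLimit.rectN n L) 0 (ψ L)) ∧
      (∀ L, star (ψ L) ⬝ᵥ ψ L = 1) ∧
      ω.IsTorusLimitOf ψ (Ls ∘ φ) ∧ ω.IsTranslationInvariant ∧ ω.IsEven ∧ ω.density = n := by
  choose ψ hψ hψ1 using fun L => exists_unit_isGroundStateInSector_hubbardTorusTT' L t t' U hn0 hn2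
  have hN : ∀ L, IsNParticle (ThermodynamicLimit.rectN n L) (ψ L) := fun L => (hψ L).isNParticle
  obtain ⟨φ, hφ, ω, hω, hTI, hev⟩ :=
    InfVolFermionState.exists_isTorusLimitOf_subseq_of_isNParticle ψ hN hLs fun j => hψ1 (Ls j)
  have hLφ : Tendsto (Ls ∘ φ) atTop atTop := hLs.comp hφ.tendsto_atTop
  exact ⟨ψ, φ, ω, hφ, hψ, hψ1, hω, hTI, hev,
    hω.density_eq_of_rectN hLφ hn0 (fun j => hN ((Ls ∘ φ) j)) fun j => hψ1 ((Ls ∘ φ) j)⟩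

/-- **Structural facts of the limits in the correlator theorems**: a torus limit of unit sector ground
states `ψ_L ∈ (rectN n L, S^z = 0)` along `Ls → ∞` is translation invariant, even, and has density
`n`. [cite: BratteliRobinsonII1997, §6.2.4] -/
theorem InfVolFermionState.IsTorusLimitOf.invariances_of_sectorGroundState_TT' (t t' U : ℝ) {n : ℝ}
    (hn0 : 0 ≤ n) {Ls : ℕ → ℕ} (hLs : Tendsto Ls atTop atTop)
    {ψ : ∀ L, Fock (Orb (FermionTorus 2 L))}
    (hψ : ∀ L, IsGroundStateInSector (hubbardTorusTT' L t t' U) (ThermodynamicLimit.rectN n L) 0 (ψ L))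
    (hψ1 : ∀ j, star (ψ (Ls j)) ⬝ᵥ ψ (Ls j) = 1)
    {ω : InfVolFermionState 2} (hω : ω.IsTorusLimitOf ψ Ls) :
    ω.IsTranslationInvariant ∧ ω.IsEven ∧ ω.density = n :=
  ⟨hω.isTranslationInvariant, hω.isEven fun L => (hψ L).isNParticle,
    hω.density_eq_of_rectN hLs hn0 (fun j => (hψ (Ls j)).isNParticle) hψ1⟩

end Limit

/-! ### The energy of the limits: torus-limit sector ground states carry `energyDensityTT'`

The `t–t'` counterpart of `InfVolFermionStateHubbardEnergy` §EnergyDensity (pure Hubbard model): the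
mean energy `ω.meanEnergy (hubbardTTPrimeFermionInteraction t t' U) 1 = Re ω(E^{tt'}_Φ)` of a torus
limit of unit sector ground states in the sectors `(rectN n L, S^z = 0)` is Ruelle's thermodynamic
energy density `energyDensityTT' t t' U n` — the ATTAINED half of the variational characterisation of
`energyDensityTT'` at density `n` (Bratteli–Kishimoto–Robinson 1978 §3 Thm. 2: translation-invariant
ground states minimise the mean energy; Ruelle 1969 §3.4). -/

section Energy

/-- **The averaged expectation of `E^{tt'}_Φ` is the energy per site**: for `L ≥ 3` and a torus vector
`ψ`, the translation-averaged expectation of the `t–t'` mean-energy observable in `ψ` is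
`⟨ψ, H^{tt'} ψ⟩ / L²`, `H^{tt'} = hubbardTorusTT' L t t' U` (its translates sum to `H^{tt'}`,
`sum_relabel_translate_hubbardTTPrime_meanEnergyObs`). [cite: BratteliRobinsonII1997, §6.2.4] -/
theorem torusAvgExpect_hubbardTTPrime_meanEnergyObs (t t' U : ℝ) {L : ℕ} (hL : 3 ≤ L)
    (ψ : Fock (Orb (FermionTorus 2 L))) :
    torusAvgExpect L (thicken ({0} : Finset (Site 2)) 1) ((hubbardTTPrimeFermionInteraction t t' U).meanEnergyObs 1) ψ =
      expect (hubbardTorusTT' L t t' U) ψ / ((L : ℂ) ^ 2) := by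
  haveI : NeZero L := ⟨by omega⟩
  have hT := injOn_proj_thicken_one (d := 2) hL
  have hcard : Fintype.card (TorusSite 2 L) = L ^ 2 := by simp [ZMod.card, Fintype.card_fin]
  rw [torusAvgExpect_eq, torusAvgExpectAt_of_injOn L hT, hcard, Nat.cast_pow, div_eq_inv_mul]
  congr 1
  have hstep : ∀ v : TorusSite 2 L,
      expect (fermionEmbed (PolySite.toTorusEmb L hT) ((hubbardTTPrimeFermionInteraction t t' U).meanEnergyObs 1))
          ((fockTranslate v).val *ᵥ ψ) =
        expect (relabel (Orb.translate (-v))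
          (fermionEmbed (PolySite.toTorusEmb L hT) ((hubbardTTPrimeFermionInteraction t t' U).meanEnergyObs 1))) ψ := by
    intro v
    rw [expect_fockRelabel_mulVec, ← Equiv.Perm.inv_def, ← Orb.translate_neg]
  simp_rw [hstep]
  rw [Fintype.sum_equiv (Equiv.neg (TorusSite 2 L))
      (fun v => expect (relabel (Orb.translate (-v))
        (fermionEmbed (PolySite.toTorusEmb L hT) ((hubbardTTPrimeFermionInteraction t t' U).meanEnergyObs 1))) ψ)
      (fun v => expect (relabel (Orb.translate v)
        (fermionEmbed (PolySite.toTorusEmb L hT) ((hubbardTTPrimeFermionInteraction t t' U).meanEnergyObs 1))) ψ)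
      (fun v => rfl)]
  have hsum : ∀ (s : Finset (TorusSite 2 L))
      (f : TorusSite 2 L → Matrix (Finset (Orb (FermionTorus 2 L))) (Finset (Orb (FermionTorus 2 L))) ℂ),
      ∑ v ∈ s, expect (f v) ψ = expect (∑ v ∈ s, f v) ψ := by
    intro s f
    rw [expect, Matrix.sum_mulVec, dotProduct_sum]
    rfl
  rw [hsum, sum_relabel_translate_hubbardTTPrime_meanEnergyObs (L := L) (t' := t') t U hL]

/-- **The `t–t'` mean energy of a thermodynamic-limit state.** If `ω` is a torus limit of `ψ` along
`Ls → ∞` and the energies per site `Re⟨ψ_j, H^{tt'} ψ_j⟩/(Ls j)²` converge to `e`, then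
`ω.meanEnergy (hubbardTTPrimeFermionInteraction t t' U) 1 = e`. Bratteli–Kishimoto–Robinson (1978) §3
(mean energy functional). [cite: BratteliKishimotoRobinson1978, §3 (mean energy functional)] -/
theorem InfVolFermionState.IsTorusLimitOf.meanEnergy_hubbardTTPrime_eq (t t' U : ℝ)
    {ω : InfVolFermionState 2} {ψ : ∀ L, Fock (Orb (FermionTorus 2 L))} {Ls : ℕ → ℕ}
    (h : ω.IsTorusLimitOf ψ Ls) (hLs : Tendsto Ls atTop atTop) {e : ℝ}
    (he : Tendsto (fun j => (star (ψ (Ls j)) ⬝ᵥ (hubbardTorusTT' (Ls j) t t' U *ᵥ ψ (Ls j))).re /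
      (Ls j : ℝ) ^ 2) atTop (𝓝 e)) :
    ω.meanEnergy (hubbardTTPrimeFermionInteraction t t' U) 1 = e := by
  have hlim := (Complex.continuous_re.tendsto _).comp
    (h (thicken ({0} : Finset (Site 2)) 1) ((hubbardTTPrimeFermionInteraction t t' U).meanEnergyObs 1))
  refine tendsto_nhds_unique hlim (he.congr' ?_)
  filter_upwards [hLs.eventually_ge_atTop 3] with j hj
  rw [Function.comp_apply, torusAvgExpect_hubbardTTPrime_meanEnergyObs t t' U hj, ← Complex.ofReal_natCast,
    ← Complex.ofReal_pow, Complex.div_ofReal_re]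
  rfl

/-- The energy per site of a unit ground state of the sector `(rectN n L, S^z = 0)` of the `t–t'`
torus is `E₀(rectN n L)/L²` (the sector ground energy is the `rectN n L`-particle ground energy,
`groundEnergy_hubbardTorusTT'_eq_minEnergyOn_szSector`). [cite: LiebPRL1989, proof of Theorem 1] -/
theorem re_rayleigh_hubbardTorusTT'_of_isGroundStateInSector_rectN (L : ℕ) [NeZero L] (t t' U : ℝ)
    {n : ℝ} (hn0 : 0 ≤ n) (hn2 : n ≤ 2) {ψ : Fock (Orb (FermionTorus 2 L))}
    (hψ : IsGroundStateInSector (hubbardTorusTT' L t t' U) (ThermodynamicLimit.rectN n L) 0 ψ)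
    (h1 : star ψ ⬝ᵥ ψ = 1) :
    (star ψ ⬝ᵥ (hubbardTorusTT' L t t' U *ᵥ ψ)).re =
      groundEnergy (hubbardTorusTT' L t t' U) (ThermodynamicLimit.rectN n L) := by
  obtain ⟨-, -, hH⟩ := hψ
  rw [hH, dotProduct_smul, h1, smul_eq_mul, mul_one, Complex.ofReal_re, rectN_eq_two_mul,
    groundEnergy_hubbardTorusTT'_eq_minEnergyOn_szSector L t t' U (half_rectN_le_card hn0 hn2 L)]

/-- **Torus limits of `t–t'` sector ground states carry the thermodynamic energy density** (the
attained half of the variational characterisation of `energyDensityTT'` at density `n`): for `U ≥ 0`,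
`0 ≤ n < 2`, unit ground states `ψ (Ls j)` of the sectors `(rectN n (Ls j), S^z = 0)` of
`hubbardTorusTT' (Ls j) t t' U` and `Ls → ∞`, every torus limit `ω` of `ψ` along `Ls` has
`ω.meanEnergy (hubbardTTPrimeFermionInteraction t t' U) 1 = energyDensityTT' t t' U n`
(`tendsto_energyDensityTT'_torus`). [cite: Ruelle1969, §3.3] -/
theorem InfVolFermionState.IsTorusLimitOf.meanEnergy_hubbardTTPrime_eq_energyDensityTT' (t t' : ℝ) {U : ℝ}
    (hU : 0 ≤ U) {n : ℝ} (hn0 : 0 ≤ n) (hn2 : n < 2)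
    {ω : InfVolFermionState 2} {ψ : ∀ L, Fock (Orb (FermionTorus 2 L))} {Ls : ℕ → ℕ}
    (h : ω.IsTorusLimitOf ψ Ls) (hLs : Tendsto Ls atTop atTop)
    (hψ : ∀ j, IsGroundStateInSector (hubbardTorusTT' (Ls j) t t' U)
      (ThermodynamicLimit.rectN n (Ls j)) 0 (ψ (Ls j)))
    (h1 : ∀ j, star (ψ (Ls j)) ⬝ᵥ ψ (Ls j) = 1) :
    ω.meanEnergy (hubbardTTPrimeFermionInteraction t t' U) 1 = ThermodynamicLimit.energyDensityTT' t t' U n := by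
  refine h.meanEnergy_hubbardTTPrime_eq t t' U hLs ?_
  have hlim := (ThermodynamicLimit.tendsto_energyDensityTT'_torus t t' hU hn0 hn2).comp hLs
  refine hlim.congr' ?_
  filter_upwards [hLs.eventually_ge_atTop 1] with j hj
  haveI : NeZero (Ls j) := ⟨by omega⟩
  simp only [Function.comp_apply]
  rw [re_rayleigh_hubbardTorusTT'_of_isGroundStateInSector_rectN (Ls j) t t' U hn0 hn2.le (hψ j) (h1 j)]

/-- **Ruelle's `t–t'` energy density is attained by a translation-invariant even state of density
`n`**: for `U ≥ 0` and `0 ≤ n < 2` there is a translation-invariant, even infinite-volume state `ω`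
of the lattice fermions on `ℤ²` with `ω.density = n` and
`ω.meanEnergy (hubbardTTPrimeFermionInteraction t t' U) 1 = energyDensityTT' t t' U n`, which is
moreover a torus limit of unit sector ground states (so the correlator theorems of §Limit apply to
it). Bratteli–Kishimoto–Robinson (1978) Thm. 2; Ruelle (1969) §3.4. [cite: Ruelle1969, §3.4] -/
theorem exists_isTorusLimitOf_meanEnergy_hubbardTTPrime_eq (t t' : ℝ) {U : ℝ} (hU : 0 ≤ U) {n : ℝ}
    (hn0 : 0 ≤ n) (hn2 : n < 2) {Ls : ℕ → ℕ} (hLs : Tendsto Ls atTop atTop) :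
    ∃ (ψ : ∀ L, Fock (Orb (FermionTorus 2 L))) (φ : ℕ → ℕ) (ω : InfVolFermionState 2),
      StrictMono φ ∧
      (∀ L, IsGroundStateInSector (hubbardTorusTT' L t t' U) (ThermodynamicLimit.rectN n L) 0 (ψ L)) ∧
      (∀ L, star (ψ L) ⬝ᵥ ψ L = 1) ∧
      ω.IsTorusLimitOf ψ (Ls ∘ φ) ∧ ω.IsTranslationInvariant ∧ ω.IsEven ∧ ω.density = n ∧
      ω.meanEnergy (hubbardTTPrimeFermionInteraction t t' U) 1 = ThermodynamicLimit.energyDensityTT' t t' U n := by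
  obtain ⟨ψ, φ, ω, hφ, hψ, hψ1, hω, hTI, hev, hdens⟩ :=
    exists_isTorusLimitOf_sectorGroundState_TT' t t' U hn0 hn2.le hLs
  have hLφ : Tendsto (Ls ∘ φ) atTop atTop := hLs.comp hφ.tendsto_atTop
  exact ⟨ψ, φ, ω, hφ, hψ, hψ1, hω, hTI, hev, hdens,
    hω.meanEnergy_hubbardTTPrime_eq_energyDensityTT' t t' hU hn0 hn2 hLφ (fun j => hψ ((Ls ∘ φ) j))
      fun j => hψ1 ((Ls ∘ φ) j)⟩

end Energy

end Literature.MathematicalPhysics.QuantumLattice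

end
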